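import Summits.QuantumFields.BalabanUV.Beta.FP.SliceVertexLoops

/-!
# `BalabanUV.Beta.FP.SliceVertexLoopsSecond` — road «FP» for binder row D1, row **GAMMA-4** (E-JET CATALOGUE, MODEL) of the owner's `GAMMA-DESIGN.md` §4
# (b2b-balaban-beta-d1-p3 gen 6, ruling R-FP-25), PART 2: THE SECOND-JET SLICE TADPOLE `tr(Γ·S̈)` TERM BY TERM — every piece reduced by (W1)∕(W2) and the
# projection calculus to a ghost leg, a `(1 − Π)` factor, or the `ḋḋ` contact

HONEST DEPENDENCY (page 1, mandatory): continuum YM on T⁴ ⇐ BetaPertH ∧ nine spine estimates (0/9 proved); BetaPertH ⇐ (D1) ∧ (D4) ∧ CAP+tail;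
G-an2-4 gates asym, D1 and NE2/3/4.  HONEST FRAMING (cell contract, verbatim): «discharging `BetaPertH` makes Bałaban's UV stability UNCONDITIONAL —
a real constructive-QFT result; it is NOT the continuum limit and NOT the Clay problem.»  THIS MODULE is [folklore] block ∕ projector ∕ trace algebra of
finite matrices over a field (PART 1 `FP/SliceVertexLoops` and RHOA-11 `FP/SliceWardKKT` BY NAME); it asserts nothing about Bałaban's operators, identifies NO
road object, proves no letter, no estimate, no power counting (GAMMA-6); cites nothing, mints no `Prop` fact, has no `def`; 0 sorry.  NOT hbook, NOT hgerm,
NOT D1, NOT BetaPertH, NOT continuum, NOT Clay.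

ABSOLUTE RULE (cell charter, verbatim): «No internally-minted statement may enter as a cited fact. Every hypothesis is either kernel-proved in this
package or a verbatim quotation of a PUBLISHED theorem with page reference. The manuscript(s) under audit are NOT citable for their own disputed
steps — they are the thing under adjudication; programme-internal (2001/route/tribunal) claims are never citable.»

THE SECOND JET OF THE SLICE (GAMMA-DESIGN §4, `S = d·Π·d^*`): with first jets `Dd` (= `ḋ`), `Pd` (= `Π̇`) and second jets `Ddd` (= `d̈`), `Pdd` (= `Π̈`),
`S̈ = d̈·Π·d^* + d·Π·d̈^* + d·Π̈·d^* + 2·(ḋ·Π̇·d^* + ḋ·Π·ḋ^* + d·Π̇·ḋ^*)` (the `2·` spelled as sums below, every characteristic).  Letters as in PART 1: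
RHOA-11's `Q·D·X = 0`, `H₀·D·X = 0`; RANGE `Pg = Dᵀ·D·X·T`, `Pg·Pg = Pg`; GHOST `Gh·(Dᵀ·D)·X = X`; symmetry `H₀ᵀ = H₀`, `Pgᵀ = Pg`, `Ghᵀ = Gh`; jet letters
`Pd = Pd·Pg + Pg·Pd`, `Pdd = Pdd·Pg + (Pd·Pd + Pd·Pd) + Pg·Pdd`; `IsUnit (kkt (H₀ + D·Pg·Dᵀ) Q).det`.

WHAT IS PROVED (operator forms first, traces by `Matrix.trace_mul_comm`).
* `jet2_tadpole_left : (d̈·Π·d^*)·Γ = d̈·Π·Gh·d^*` and `jet2_tadpole_right : Γ·(d·Π·d̈^*) = d·Gh·Π·d̈^*` ((W2)∕(W1));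
* `mixed_tadpole_left : (ḋ·Π̇·d^*)·Γ = ḋ·(1−Π)·Π̇·Π·Gh·d^* + ḋ·Π·Π̇·(1−Π)·d^*·Γ` and `mixed_tadpole_right : Γ·(d·Π̇·ḋ^*) = Γ·d·(1−Π)·Π̇·Π·ḋ^* + d·Gh·Π·Π̇·(1−Π)·ḋ^*`
  (jet split + (W1)∕(W2));
* `jet2_four_blocks : Π̈ = Π·Π̈·Π + Π·Π̈·(1−Π) + (1−Π)·Π̈·Π + (1−Π)·Π̈·(1−Π)` and **`trace_flucCov_D_jet2_Dt`**:
  `tr(Γ·d·Π̈·d^*) = −(tr(Π̇·Π̇·Π·Gh·Δ·Π) + tr(Π̇·Π̇·Π·Gh·Δ·Π)) + tr(Π̈·(1−Π)·Δ·Gh·Π) + tr(Π̈·Π·Gh·Δ·(1−Π)) + (tr((1−Π)·Π̇·Π̇·(1−Π)·d^*·Γ·d) × 2 as a sum)`,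
  `Δ := DᵀD` — the `Π̈` tadpole is a ghost bubble on `range Π` plus `(1−Π)` pieces;
* the six TRACE forms and their SUM **`trace_flucCov_jet2_slice`**: `tr(Γ·S̈)` = the displayed list (ghost legs, `(1−Π)` factors, and the `ḋ·Π·ḋ^*` contact).
Provenance: G-an2-4 formalisation swarm seat b2b-balaban-gan24-formalise-leaf-01 gen 49 (cross-lane on road FP, row GAMMA-4 PART 2), 2026-08-21.
-/

namespace Summit.QuantumFields.BalabanUV.Beta.FP.SliceVertexLoopsSecond

open scoped Matrix
open Matrix
open Literature.MathematicalPhysics.QuantumFieldTheory.Balaban1983to89.Beta.Composition (kkt)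
open Literature.MathematicalPhysics.QuantumFieldTheory.Balaban1983to89.Beta.CompositionSingular (flucCov minOp minOpL effForm)
open Summit.QuantumFields.BalabanUV.Beta.FP.SliceVertexLoops (flucCov_D_proj proj_Dt_flucCov jet_split proj_mul_jet2_mul_proj coproj_mul_jet2_mul_coproj)

variable {𝕜 : Type*} [Field 𝕜]
variable {ν μ κ σ : Type*} [Fintype ν] [Fintype μ] [Fintype κ] [Fintype σ] [DecidableEq ν] [DecidableEq μ] [DecidableEq σ]

variable {H₀ : Matrix ν ν 𝕜} {Q : Matrix μ ν 𝕜} {D Dd Ddd : Matrix ν σ 𝕜} {Pg Pd Pdd Gh : Matrix σ σ 𝕜} {X : Matrix σ κ 𝕜} {T : Matrix κ σ 𝕜}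

/-! ## §1 The `d̈` tadpoles -/

omit [DecidableEq σ] in
/-- [our object] `(d̈·Π·d^*)·Γ = d̈·Π·Gh·d^*` ((W2)). -/
theorem jet2_tadpole_left (h : IsUnit (kkt (H₀ + D * Pg * Dᵀ) Q).det) (hH₀t : H₀ᵀ = H₀) (hPt : Pgᵀ = Pg) (hGht : Ghᵀ = Gh)
    (hQ : Q * D * X = 0) (hH₀ : H₀ * D * X = 0) (hP : Pg * Pg = Pg) (hrange : Pg = Dᵀ * D * X * T) (hGh : Gh * (Dᵀ * D) * X = X) :
    Ddd * Pg * Dᵀ * flucCov (H₀ + D * Pg * Dᵀ) Q = Ddd * Pg * Gh * Dᵀ := by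
  have w2 := proj_Dt_flucCov h hH₀t hPt hGht hQ hH₀ hP hrange hGh
  calc Ddd * Pg * Dᵀ * flucCov (H₀ + D * Pg * Dᵀ) Q = Ddd * (Pg * Dᵀ * flucCov (H₀ + D * Pg * Dᵀ) Q) := by simp only [Matrix.mul_assoc]
    _ = Ddd * (Pg * Gh * Dᵀ) := by rw [w2]
    _ = Ddd * Pg * Gh * Dᵀ := by simp only [Matrix.mul_assoc]

omit [DecidableEq σ] in
/-- [our object] `Γ·(d·Π·d̈^*) = d·Gh·Π·d̈^*` ((W1)). -/
theorem jet2_tadpole_right (h : IsUnit (kkt (H₀ + D * Pg * Dᵀ) Q).det) (hQ : Q * D * X = 0) (hH₀ : H₀ * D * X = 0) (hP : Pg * Pg = Pg)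
    (hrange : Pg = Dᵀ * D * X * T) (hGh : Gh * (Dᵀ * D) * X = X) :
    flucCov (H₀ + D * Pg * Dᵀ) Q * (D * Pg * Dddᵀ) = D * Gh * Pg * Dddᵀ := by
  have w1 := flucCov_D_proj h hQ hH₀ hP hrange hGh
  calc flucCov (H₀ + D * Pg * Dᵀ) Q * (D * Pg * Dddᵀ) = (flucCov (H₀ + D * Pg * Dᵀ) Q * D * Pg) * Dddᵀ := by simp only [Matrix.mul_assoc]
    _ = D * Gh * Pg * Dddᵀ := by rw [w1]

/-! ## §2 The mixed `ḋ·Π̇` tadpoles -/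

/-- [our object] `(ḋ·Π̇·d^*)·Γ = ḋ·(1−Π)·Π̇·Π·Gh·d^* + ḋ·Π·Π̇·(1−Π)·d^*·Γ` (jet split + (W2)). -/
theorem mixed_tadpole_left (h : IsUnit (kkt (H₀ + D * Pg * Dᵀ) Q).det) (hH₀t : H₀ᵀ = H₀) (hPt : Pgᵀ = Pg) (hGht : Ghᵀ = Gh)
    (hQ : Q * D * X = 0) (hH₀ : H₀ * D * X = 0) (hP : Pg * Pg = Pg) (hrange : Pg = Dᵀ * D * X * T) (hGh : Gh * (Dᵀ * D) * X = X)
    (hd : Pd = Pd * Pg + Pg * Pd) :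
    Dd * Pd * Dᵀ * flucCov (H₀ + D * Pg * Dᵀ) Q =
      Dd * (1 - Pg) * Pd * Pg * Gh * Dᵀ + Dd * Pg * Pd * (1 - Pg) * Dᵀ * flucCov (H₀ + D * Pg * Dᵀ) Q := by
  set Γ := flucCov (H₀ + D * Pg * Dᵀ) Q with hΓ
  have w2 : Pg * Dᵀ * Γ = Pg * Gh * Dᵀ := proj_Dt_flucCov h hH₀t hPt hGht hQ hH₀ hP hrange hGh
  have sA : Dd * ((1 - Pg) * Pd * Pg) * Dᵀ * Γ = Dd * (1 - Pg) * Pd * Pg * Gh * Dᵀ := by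
    calc Dd * ((1 - Pg) * Pd * Pg) * Dᵀ * Γ = Dd * (1 - Pg) * Pd * (Pg * Dᵀ * Γ) := by simp only [Matrix.mul_assoc]
      _ = Dd * (1 - Pg) * Pd * (Pg * Gh * Dᵀ) := by rw [w2]
      _ = Dd * (1 - Pg) * Pd * Pg * Gh * Dᵀ := by simp only [Matrix.mul_assoc]
  have sB : Dd * (Pg * Pd * (1 - Pg)) * Dᵀ * Γ = Dd * Pg * Pd * (1 - Pg) * Dᵀ * Γ := by simp only [Matrix.mul_assoc]
  calc Dd * Pd * Dᵀ * Γ = Dd * ((1 - Pg) * Pd * Pg + Pg * Pd * (1 - Pg)) * Dᵀ * Γ := by rw [← jet_split hP hd]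
    _ = Dd * ((1 - Pg) * Pd * Pg) * Dᵀ * Γ + Dd * (Pg * Pd * (1 - Pg)) * Dᵀ * Γ := by
        rw [Matrix.mul_add, Matrix.add_mul, Matrix.add_mul]
    _ = Dd * (1 - Pg) * Pd * Pg * Gh * Dᵀ + Dd * Pg * Pd * (1 - Pg) * Dᵀ * Γ := by rw [sA, sB]

/-- [our object] `Γ·(d·Π̇·ḋ^*) = Γ·d·(1−Π)·Π̇·Π·ḋ^* + d·Gh·Π·Π̇·(1−Π)·ḋ^*` (jet split + (W1)). -/
theorem mixed_tadpole_right (h : IsUnit (kkt (H₀ + D * Pg * Dᵀ) Q).det) (hQ : Q * D * X = 0) (hH₀ : H₀ * D * X = 0) (hP : Pg * Pg = Pg)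
    (hrange : Pg = Dᵀ * D * X * T) (hGh : Gh * (Dᵀ * D) * X = X) (hd : Pd = Pd * Pg + Pg * Pd) :
    flucCov (H₀ + D * Pg * Dᵀ) Q * (D * Pd * Ddᵀ) =
      flucCov (H₀ + D * Pg * Dᵀ) Q * D * (1 - Pg) * Pd * Pg * Ddᵀ + D * Gh * Pg * Pd * (1 - Pg) * Ddᵀ := by
  set Γ := flucCov (H₀ + D * Pg * Dᵀ) Q with hΓ
  have w1 : Γ * D * Pg = D * Gh * Pg := flucCov_D_proj h hQ hH₀ hP hrange hGh
  have sA : Γ * (D * ((1 - Pg) * Pd * Pg) * Ddᵀ) = Γ * D * (1 - Pg) * Pd * Pg * Ddᵀ := by simp only [Matrix.mul_assoc]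
  have sB : Γ * (D * (Pg * Pd * (1 - Pg)) * Ddᵀ) = D * Gh * Pg * Pd * (1 - Pg) * Ddᵀ := by
    calc Γ * (D * (Pg * Pd * (1 - Pg)) * Ddᵀ) = (Γ * D * Pg) * (Pd * (1 - Pg) * Ddᵀ) := by simp only [Matrix.mul_assoc]
      _ = (D * Gh * Pg) * (Pd * (1 - Pg) * Ddᵀ) := by rw [w1]
      _ = D * Gh * Pg * Pd * (1 - Pg) * Ddᵀ := by simp only [Matrix.mul_assoc]
  calc Γ * (D * Pd * Ddᵀ) = Γ * (D * ((1 - Pg) * Pd * Pg + Pg * Pd * (1 - Pg)) * Ddᵀ) := by rw [← jet_split hP hd]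
    _ = Γ * (D * ((1 - Pg) * Pd * Pg) * Ddᵀ) + Γ * (D * (Pg * Pd * (1 - Pg)) * Ddᵀ) := by
        rw [Matrix.mul_add, Matrix.add_mul, Matrix.mul_add]
    _ = Γ * D * (1 - Pg) * Pd * Pg * Ddᵀ + D * Gh * Pg * Pd * (1 - Pg) * Ddᵀ := by rw [sA, sB]

/-! ## §3 The `Π̈` tadpole -/

omit [Fintype ν] [Fintype μ] [Fintype κ] [DecidableEq ν] [DecidableEq μ] in
/-- [folklore] the four-block decomposition of any `σ × σ` matrix against the projector: `M = Π·M·Π + Π·M·(1−Π) + (1−Π)·M·Π + (1−Π)·M·(1−Π)`. -/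
theorem jet2_four_blocks (M : Matrix σ σ 𝕜) :
    M = Pg * M * Pg + Pg * M * (1 - Pg) + (1 - Pg) * M * Pg + (1 - Pg) * M * (1 - Pg) := by
  noncomm_ring

/-- [our object] **THE `Π̈` TADPOLE** `tr(Γ·d·Π̈·d^*)`, block by block (`Δ := DᵀD`): the range block is a GHOST BUBBLE
`−(tr(Π̇·Π̇·Π·Gh·Δ·Π) + tr(Π̇·Π̇·Π·Gh·Δ·Π))`, the two mixed blocks are `tr(Π̈·(1−Π)·Δ·Gh·Π) + tr(Π̈·Π·Gh·Δ·(1−Π))`, the kernel block is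
`tr((1−Π)·Π̇·Π̇·(1−Π)·d^*·Γ·d)` twice — every piece carries a ghost leg or a `(1−Π)`. -/
theorem trace_flucCov_D_jet2_Dt (h : IsUnit (kkt (H₀ + D * Pg * Dᵀ) Q).det) (hH₀t : H₀ᵀ = H₀) (hPt : Pgᵀ = Pg) (hGht : Ghᵀ = Gh)
    (hQ : Q * D * X = 0) (hH₀ : H₀ * D * X = 0) (hP : Pg * Pg = Pg) (hrange : Pg = Dᵀ * D * X * T) (hGh : Gh * (Dᵀ * D) * X = X)
    (hdd : Pdd = Pdd * Pg + (Pd * Pd + Pd * Pd) + Pg * Pdd) :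
    (flucCov (H₀ + D * Pg * Dᵀ) Q * (D * Pdd * Dᵀ)).trace =
      -((Pd * Pd * (Pg * Gh * (Dᵀ * D) * Pg)).trace + (Pd * Pd * (Pg * Gh * (Dᵀ * D) * Pg)).trace) +
        (Pdd * ((1 - Pg) * (Dᵀ * D) * Gh * Pg)).trace + (Pdd * (Pg * Gh * (Dᵀ * D) * (1 - Pg))).trace +
        (((1 - Pg) * Pd * Pd * (1 - Pg) * (Dᵀ * flucCov (H₀ + D * Pg * Dᵀ) Q * D)).trace +
          ((1 - Pg) * Pd * Pd * (1 - Pg) * (Dᵀ * flucCov (H₀ + D * Pg * Dᵀ) Q * D)).trace) := by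
  set Γ := flucCov (H₀ + D * Pg * Dᵀ) Q with hΓ
  have w1 : Γ * D * Pg = D * Gh * Pg := flucCov_D_proj h hQ hH₀ hP hrange hGh
  have w2 : Pg * Dᵀ * Γ = Pg * Gh * Dᵀ := proj_Dt_flucCov h hH₀t hPt hGht hQ hH₀ hP hrange hGh
  -- move `Γ·D` to the right: `tr(Γ·D·Π̈·Dᵀ) = tr(Π̈·(Dᵀ·Γ·D))`
  have hcyc : (Γ * (D * Pdd * Dᵀ)).trace = (Pdd * (Dᵀ * Γ * D)).trace := by
    rw [show Γ * (D * Pdd * Dᵀ) = (Γ * D) * (Pdd * Dᵀ) by simp only [Matrix.mul_assoc], Matrix.trace_mul_comm,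
      show Pdd * Dᵀ * (Γ * D) = Pdd * (Dᵀ * Γ * D) by simp only [Matrix.mul_assoc]]
  -- the sandwiches of `B := Dᵀ·Γ·D` by the projector
  have bPP : Pg * (Dᵀ * Γ * D) * Pg = Pg * Gh * (Dᵀ * D) * Pg := by
    calc Pg * (Dᵀ * Γ * D) * Pg = (Pg * Dᵀ * Γ) * D * Pg := by simp only [Matrix.mul_assoc]
      _ = Pg * Gh * Dᵀ * D * Pg := by rw [w2]
      _ = Pg * Gh * (Dᵀ * D) * Pg := by simp only [Matrix.mul_assoc]
  have bXP : (1 - Pg) * (Dᵀ * Γ * D) * Pg = (1 - Pg) * (Dᵀ * D) * Gh * Pg := by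
    calc (1 - Pg) * (Dᵀ * Γ * D) * Pg = (1 - Pg) * Dᵀ * (Γ * D * Pg) := by simp only [Matrix.mul_assoc]
      _ = (1 - Pg) * Dᵀ * (D * Gh * Pg) := by rw [w1]
      _ = (1 - Pg) * (Dᵀ * D) * Gh * Pg := by simp only [Matrix.mul_assoc]
  have bPX : Pg * (Dᵀ * Γ * D) * (1 - Pg) = Pg * Gh * (Dᵀ * D) * (1 - Pg) := by
    calc Pg * (Dᵀ * Γ * D) * (1 - Pg) = (Pg * Dᵀ * Γ) * D * (1 - Pg) := by simp only [Matrix.mul_assoc]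
      _ = Pg * Gh * Dᵀ * D * (1 - Pg) := by rw [w2]
      _ = Pg * Gh * (Dᵀ * D) * (1 - Pg) := by simp only [Matrix.mul_assoc]
  -- decompose `Π̈` into its four blocks inside the trace and use cyclicity blockwise
  have hPP := proj_mul_jet2_mul_proj hP hdd
  have hXX := coproj_mul_jet2_mul_coproj hP hdd
  have key : (Pdd * (Dᵀ * Γ * D)).trace =
      (Pg * Pdd * Pg * (Dᵀ * Γ * D)).trace + (Pg * Pdd * (1 - Pg) * (Dᵀ * Γ * D)).trace +
        ((1 - Pg) * Pdd * Pg * (Dᵀ * Γ * D)).trace + ((1 - Pg) * Pdd * (1 - Pg) * (Dᵀ * Γ * D)).trace := by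
    conv_lhs => rw [jet2_four_blocks (Pg := Pg) Pdd]
    simp only [Matrix.add_mul, Matrix.trace_add]
  -- block PP: substitute `Π·Π̈·Π = −(ΠΠ̇Π̇Π + ΠΠ̇Π̇Π)` and move the leading `Π` round the trace
  have tPP : (Pg * Pdd * Pg * (Dᵀ * Γ * D)).trace =
      -((Pd * Pd * (Pg * Gh * (Dᵀ * D) * Pg)).trace + (Pd * Pd * (Pg * Gh * (Dᵀ * D) * Pg)).trace) := by
    have e2 : (Pg * Pd * Pd * Pg * (Dᵀ * Γ * D)).trace = (Pd * Pd * (Pg * Gh * (Dᵀ * D) * Pg)).trace := by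
      rw [show Pg * Pd * Pd * Pg * (Dᵀ * Γ * D) = Pg * (Pd * Pd * Pg * (Dᵀ * Γ * D)) by simp only [Matrix.mul_assoc], Matrix.trace_mul_comm,
        show Pd * Pd * Pg * (Dᵀ * Γ * D) * Pg = Pd * Pd * (Pg * (Dᵀ * Γ * D) * Pg) by simp only [Matrix.mul_assoc], bPP]
    rw [hPP]
    simp only [Matrix.neg_mul, Matrix.add_mul, Matrix.trace_neg, Matrix.trace_add, e2]
  -- block PX
  have tPX : (Pg * Pdd * (1 - Pg) * (Dᵀ * Γ * D)).trace = (Pdd * ((1 - Pg) * (Dᵀ * D) * Gh * Pg)).trace := by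
    rw [show Pg * Pdd * (1 - Pg) * (Dᵀ * Γ * D) = Pg * (Pdd * (1 - Pg) * (Dᵀ * Γ * D)) by simp only [Matrix.mul_assoc], Matrix.trace_mul_comm,
      show Pdd * (1 - Pg) * (Dᵀ * Γ * D) * Pg = Pdd * ((1 - Pg) * (Dᵀ * Γ * D) * Pg) by simp only [Matrix.mul_assoc], bXP]
  -- block XP
  have tXP : ((1 - Pg) * Pdd * Pg * (Dᵀ * Γ * D)).trace = (Pdd * (Pg * Gh * (Dᵀ * D) * (1 - Pg))).trace := by
    rw [show (1 - Pg) * Pdd * Pg * (Dᵀ * Γ * D) = (1 - Pg) * (Pdd * Pg * (Dᵀ * Γ * D)) by simp only [Matrix.mul_assoc], Matrix.trace_mul_comm,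
      show Pdd * Pg * (Dᵀ * Γ * D) * (1 - Pg) = Pdd * (Pg * (Dᵀ * Γ * D) * (1 - Pg)) by simp only [Matrix.mul_assoc], bPX]
  -- block XX
  have hXXproj : (1 - Pg) * (1 - Pg) = 1 - Pg := by
    simp only [Matrix.sub_mul, Matrix.mul_sub, Matrix.one_mul, Matrix.mul_one, hP]; abel
  have tXX : ((1 - Pg) * Pdd * (1 - Pg) * (Dᵀ * Γ * D)).trace =
      ((1 - Pg) * Pd * Pd * (1 - Pg) * (Dᵀ * Γ * D)).trace + ((1 - Pg) * Pd * Pd * (1 - Pg) * (Dᵀ * Γ * D)).trace := by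
    rw [hXX, Matrix.add_mul, Matrix.trace_add]
  rw [hcyc, key, tPP, tPX, tXP, tXX]

/-! ## §4 The assembled second-jet tadpole -/

/-- [our object] **`tr(Γ·S̈)` REDUCED** (GAMMA-DESIGN §4 «`−½tr(ΓS̈)`: each has ≥ 1 factor from {`(1−Π)`, ghost, `ḋḋ` contact}»): with
`S̈ = d̈Πd^* + dΠd̈^* + dΠ̈d^* + (ḋΠ̇d^* + ḋΠ̇d^*) + (ḋΠḋ^* + ḋΠḋ^*) + (dΠ̇ḋ^* + dΠ̇ḋ^*)`,
`tr(Γ·S̈) = tr(d̈·Π·Gh·d^*) + tr(d·Gh·Π·d̈^*) + tr(Γ·d·Π̈·d^*) [= trace_flucCov_D_jet2_Dt] + 2·tr(ḋ(1−Π)Π̇ΠGhd^* + ḋΠΠ̇(1−Π)d^*Γ) + 2·tr(Γḋ Πḋ^*)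
+ 2·tr(Γd(1−Π)Π̇Πḋ^* + dGhΠΠ̇(1−Π)ḋ^*)` (the `2·` as sums). -/
theorem trace_flucCov_jet2_slice (h : IsUnit (kkt (H₀ + D * Pg * Dᵀ) Q).det) (hH₀t : H₀ᵀ = H₀) (hPt : Pgᵀ = Pg) (hGht : Ghᵀ = Gh)
    (hQ : Q * D * X = 0) (hH₀ : H₀ * D * X = 0) (hP : Pg * Pg = Pg) (hrange : Pg = Dᵀ * D * X * T) (hGh : Gh * (Dᵀ * D) * X = X)
    (hd : Pd = Pd * Pg + Pg * Pd) :
    (flucCov (H₀ + D * Pg * Dᵀ) Q *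
        (Ddd * Pg * Dᵀ + D * Pg * Dddᵀ + D * Pdd * Dᵀ + (Dd * Pd * Dᵀ + Dd * Pd * Dᵀ) + (Dd * Pg * Ddᵀ + Dd * Pg * Ddᵀ) +
          (D * Pd * Ddᵀ + D * Pd * Ddᵀ))).trace =
      (Ddd * Pg * Gh * Dᵀ).trace + (D * Gh * Pg * Dddᵀ).trace + (flucCov (H₀ + D * Pg * Dᵀ) Q * (D * Pdd * Dᵀ)).trace +
        ((Dd * (1 - Pg) * Pd * Pg * Gh * Dᵀ + Dd * Pg * Pd * (1 - Pg) * Dᵀ * flucCov (H₀ + D * Pg * Dᵀ) Q).trace +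
          (Dd * (1 - Pg) * Pd * Pg * Gh * Dᵀ + Dd * Pg * Pd * (1 - Pg) * Dᵀ * flucCov (H₀ + D * Pg * Dᵀ) Q).trace) +
        ((flucCov (H₀ + D * Pg * Dᵀ) Q * (Dd * Pg * Ddᵀ)).trace + (flucCov (H₀ + D * Pg * Dᵀ) Q * (Dd * Pg * Ddᵀ)).trace) +
        ((flucCov (H₀ + D * Pg * Dᵀ) Q * D * (1 - Pg) * Pd * Pg * Ddᵀ + D * Gh * Pg * Pd * (1 - Pg) * Ddᵀ).trace +
          (flucCov (H₀ + D * Pg * Dᵀ) Q * D * (1 - Pg) * Pd * Pg * Ddᵀ + D * Gh * Pg * Pd * (1 - Pg) * Ddᵀ).trace) := by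
  set Γ := flucCov (H₀ + D * Pg * Dᵀ) Q with hΓ
  have t1 : (Γ * (Ddd * Pg * Dᵀ)).trace = (Ddd * Pg * Gh * Dᵀ).trace := by
    rw [Matrix.trace_mul_comm, jet2_tadpole_left h hH₀t hPt hGht hQ hH₀ hP hrange hGh]
  have t2 : (Γ * (D * Pg * Dddᵀ)).trace = (D * Gh * Pg * Dddᵀ).trace := by
    rw [jet2_tadpole_right h hQ hH₀ hP hrange hGh]
  have t4 : (Γ * (Dd * Pd * Dᵀ)).trace = (Dd * (1 - Pg) * Pd * Pg * Gh * Dᵀ + Dd * Pg * Pd * (1 - Pg) * Dᵀ * Γ).trace := by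
    rw [Matrix.trace_mul_comm, mixed_tadpole_left h hH₀t hPt hGht hQ hH₀ hP hrange hGh hd]
  have t6 : (Γ * (D * Pd * Ddᵀ)).trace = (Γ * D * (1 - Pg) * Pd * Pg * Ddᵀ + D * Gh * Pg * Pd * (1 - Pg) * Ddᵀ).trace := by
    rw [mixed_tadpole_right h hQ hH₀ hP hrange hGh hd]
  simp only [Matrix.mul_add, Matrix.trace_add, t1, t2, t4, t6]

end Summit.QuantumFields.BalabanUV.Beta.FP.SliceVertexLoopsSecond
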